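import Literature.NumberTheory.Rogawski1990.CMThetaDockingClauses                    -- ★ `CMThetaDockingClauses` (the DOCK predicate), `KeysCaseTwoLabels`, `CMNonsplitCharIdentityAt`, `ThetaTypeAtCM`
import Literature.NumberTheory.Rogawski1990.CMThetaDockingClausesTest                -- ★ p840296 T-1 (ED. 2): `CMThetaDockingClausesTest` + (via it) ★ `LocalAPacket.CharIdentityAtTest`
import Literature.NumberTheory.Rogawski1990.CohDiscreteMemXiFamilyArchPinned            -- ★ S2♯ statement file: cotangent vocabulary `IsHolCotangentAt`∕`cmArchSection`∕`cmCompactFactor`, `MemXiFamily`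
import Summits.HodgeConjecture.HodgeConjecture.Theorems.F0P3XiPacketFamilyOfRecord      -- ★ p819611: `xiPacketFamilyOfRecord` (the packet family OF RECORD)
import HarnessLib

/-!
# Crux `H413`, programme P2 — THE D7α NODE OF RECORD, PER MEASURE: `StubD7αMemDockPerMeasure` (statement only)

Cell `hodgecm-mathlib` (D-0151), FLOOR 0, crux item H413 = `stmt-HodgeConjecture-24833`, route of record `HCCMUnconditional`; programme P2, fallback road PKΠ
`Cruxes/H413/Lines/F0_P2PKPiRung4.lean`.  Desk F0P2-plan (g9) RULING on SPEC (D7α-J) (2026-09-01T01:50:14Z, (Q1∕J1) «RE-CUT ∀∃»; SPEC `F0/P2/p01/g9/SPEC-D7alpha-of-letters.md`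
7018008cb4df3907): the statement of record for the D7α node becomes PER-MEASURE.  F0P2-p01 (g9).  DEFINITION ONLY (one `def … : Prop` with body + its `Iff.rfl` unfolding);
no theorem with content, no instance, no notation, no `sorry`; `--supports stmt-HodgeConjecture-24833 --as helper`.  HONEST LABEL: HC_CM is proved only modulo the printed citations
until rung 0 closes; this file ASSERTS NOTHING — it names a statement.

THE TEXT.  `StubD7αMemDockPerMeasure` is the body of PKΠ v1.13 (commit 5db8a2fd3614, sha16 34a84eae3b17e3d1) `def StubD7αMemDock` (:586–:657) BY PASTE with EXACTLY ONE change: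
the binder `∀ (μ : Measure …automorphicQuotient) [… IsAutomorphicMeasure μ]` that led the MEM conjunct is MOVED to the prefix, right after `hquad →` and before the `letI` borel
lines (which stay where they were); DOCK and every other token unchanged.  So the node reads: for every frame `(L ι H T hT) hdef h2 (μω hμu) hquad` AND EVERY automorphic measure
`μ`, THERE EXIST record data `(Δ, mH, mG, νG, νH, ξloc, μZ, keys, hCM)` with `μZ` Haar such that (DOCK) the theta-docking clause ★ `CMThetaDockingClauses` holds for every theta frame and
every `ξ`, and (MEM_μ) every local constituent class of a cotangent `μ`-discrete `P`'s finite component at a non-split place lies in the packet OF RECORD ★ `xiPacketFamilyOfRecord … ξ v`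
of EVERY `ξ` with `MemXiFamily P … ξ`.  WEAKER than v1.13's `∃∀` (the data may depend on `μ`); it is exactly what PKΠ's only consumer `stub_RIGfDict` uses (`μ` is in scope before its
`obtain`), and it matches the producer (the closer's rung-0 choice `rung0Choice … μ …` ∕ `FrameData … μ` are per-`μ`).  WHY A THEOREMS-LEVEL CONSTANT: so that every pen folds ONE
token — PKΠ v1.14 carries `stub_D7αMemDockμ : StubD7αMemDockPerMeasure` BY NAME (desk), the Lines-free brick `F0P2oD7alphaMemDockOfRows.stubD7αMemDockPerMeasure_of_rows` concludes it
BY NAME (p01), and the closer discharges it at `rung0Choice` (F0P3 desk).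

EDITION 2 (T8-21 repair, F0P2-p01 (g9), 2026-09-01): §2 adds `StubD7αMemDockPerMeasureT` — the same node ON TEST FUNCTIONS and PACKET-LEVEL (DOCKᵀ = ★ `CMThetaDockingClausesTest`,
SHAPE of the packet at non-split `v` with the (13.1.4) identity ON TEST FUNCTIONS, MEM_μ into that packet); §1 is byte-identical (★ p839951, kept as the negative edge).

References: [Rogawski1990] §13.1 Prop. 13.1.3 (d), Prop. 13.1.4 p. 199; §12.2 (2) pp. 173–174; Thm. 13.3.7; §14.6 p. 246.  [GelbartRogawski1991] Lem. 5.1.2 p. 466.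
-/

set_option autoImplicit false
-- the mandated namespace repeats `HodgeConjecture.HodgeConjecture`, as in every `Theorems/*.lean` of this sub-problem
set_option linter.dupNamespace false

noncomputable section

open NumberField MeasureTheory IsDedekindDomain
open scoped Matrix ComplexOrder

namespace Summit.HodgeConjecture.HodgeConjecture.Cruxes.H413.F0P2oD7alphaMemDockStatement

open Literature.NumberTheory Literature.NumberTheory.Automorphic Literature.NumberTheory.Automorphic.UnitaryGroup
open Literature.NumberTheory.Automorphic.UnitaryGroup.CotangentForms
open Literature.NumberTheory.Automorphic.IdeleClassGroup
open Literature.NumberTheory.GelbartRogawski1991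
open Literature.NumberTheory.GaloisRepresentations
open Literature.NumberTheory.Rogawski1990

set_option synthInstance.maxHeartbeats 400000 in
set_option maxHeartbeats 8000000 in
/-- **MEM + DOCK, PER MEASURE (the D7α node of record since desk F0P2-plan (g9) 2026-09-01T01:50:14Z)**: for every frame AND every automorphic measure `μ`, record data
`(Δ, mH, mG, νG, νH, ξloc, μZ, keys, hCM)` exist such that (DOCK) the theta-docking clause [Rogawski1990 Prop. 13.1.3 (d), 13.1.4; GelbartRogawski1991 Lem. 5.1.2] holds for every
theta frame and every `ξ`, and (MEM_μ) every local constituent class of a cotangent `μ`-discrete `P`'s finite component at a non-split place lies in the packet OF RECORD of its `ξ`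
(★ `xiPacketFamilyOfRecord`) [Rogawski1990 Thm. 13.3.7, §14.6].  = PKΠ v1.13 `def StubD7αMemDock` BY PASTE with the `∀ μ` binder moved from the MEM conjunct to the prefix.
An ENGINE node (a closed `Prop` of the line tree, no cite tag on a closed-header `def`, D246), not a print letter.
(print: Rogawski1990, §13.1 Prop. 13.1.3 (d), Prop. 13.1.4 p. 199; Thm. 13.3.7; §14.6 p. 246) (print: GelbartRogawski1991, Lem. 5.1.2 p. 466) -/
def StubD7αMemDockPerMeasure : Prop :=
  ∀ (L : Type) [Field L] [NumberField L] [IsCMField L] (ι : L →+* ℂ) (H : Matrix (Fin 3) (Fin 3) L) (T : GL (Fin 3) ℂ)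
    (hT : (T : Matrix (Fin 3) (Fin 3) ℂ)ᴴ * H.map ι * (T : Matrix (Fin 3) (Fin 3) ℂ) = Literature.Geometry.ComplexHyperbolic.BallModel.J),
    (∀ τ' : L →+* ℂ, InfinitePlace.mk τ' ≠ InfinitePlace.mk ι → (H.map τ').PosDef) → 2 ≤ Module.finrank ℚ ↥(maximalRealSubfield L) →
    ∀ (μω : HeckeCharacter L) (hμu : μω.IsUnitary),
      (∀ x : Literature.NumberTheory.GaloisRepresentations.ideleGroup ↥(maximalRealSubfield L), μω (AdeleRing.ideleBaseChange (↥(maximalRealSubfield L)) L x) = quadraticHeckeCharCM L x) →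
    ∀ (μ : Measure (adelicGroupData (↥(maximalRealSubfield L)) L (IsCMField.complexConj L) 3 H).automorphicQuotient) [(adelicGroupData (↥(maximalRealSubfield L)) L (IsCMField.complexConj L) 3 H).IsAutomorphicMeasure μ],
    letI : ∀ v : HeightOneSpectrum (𝓞 ↥(maximalRealSubfield L)), MeasurableSpace ((cmDatum L 3 H).Local v) := fun _ => borel _
    letI : ∀ v : HeightOneSpectrum (𝓞 ↥(maximalRealSubfield L)),
        MeasurableSpace ((cmDatum L 2 (Matrix.of fun i j : Fin 2 => if i.val + j.val + 1 = 2 then (1 : L) else 0)).Local v ×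
          (cmDatum L 1 (Matrix.of fun i j : Fin 1 => if i.val + j.val + 1 = 1 then (1 : L) else 0)).Local v) := fun _ => borel _
    letI : ∀ (v : HeightOneSpectrum (𝓞 ↥(maximalRealSubfield L)))
        (a : ((cmDatum L 2 (Matrix.of fun i j : Fin 2 => if i.val + j.val + 1 = 2 then (1 : L) else 0)).Local v ×
          (cmDatum L 1 (Matrix.of fun i j : Fin 1 => if i.val + j.val + 1 = 1 then (1 : L) else 0)).Local v)),
        MeasurableSpace (((cmDatum L 2 (Matrix.of fun i j : Fin 2 => if i.val + j.val + 1 = 2 then (1 : L) else 0)).Local v ×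
            (cmDatum L 1 (Matrix.of fun i j : Fin 1 => if i.val + j.val + 1 = 1 then (1 : L) else 0)).Local v) ⧸
          Subgroup.centralizer ({a} : Set ((cmDatum L 2 (Matrix.of fun i j : Fin 2 => if i.val + j.val + 1 = 2 then (1 : L) else 0)).Local v ×
            (cmDatum L 1 (Matrix.of fun i j : Fin 1 => if i.val + j.val + 1 = 1 then (1 : L) else 0)).Local v))) := fun _ _ => borel _
    letI : ∀ (v : HeightOneSpectrum (𝓞 ↥(maximalRealSubfield L))) (γ : (cmDatum L 3 H).Local v),
        MeasurableSpace ((cmDatum L 3 H).Local v ⧸ Subgroup.centralizer ({γ} : Set ((cmDatum L 3 H).Local v))) := fun _ _ => borel _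
    letI : ∀ v : HeightOneSpectrum (𝓞 ↥(maximalRealSubfield L)), MeasurableSpace (Gqs L v ⧸ Subgroup.center (Gqs L v)) := fun _ => borel _
    ∃ (Δ : ∀ v : HeightOneSpectrum (𝓞 ↥(maximalRealSubfield L)), LocalTransferFactor L H v)
      (mH : ∀ v : HeightOneSpectrum (𝓞 ↥(maximalRealSubfield L)),
    OrbitalMeasureFamily ((cmDatum L 2 (Matrix.of fun i j : Fin 2 => if i.val + j.val + 1 = 2 then (1 : L) else 0)).Local v ×
      (cmDatum L 1 (Matrix.of fun i j : Fin 1 => if i.val + j.val + 1 = 1 then (1 : L) else 0)).Local v))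
      (mG : ∀ v : HeightOneSpectrum (𝓞 ↥(maximalRealSubfield L)), OrbitalMeasureFamily ((cmDatum L 3 H).Local v))
      (νG : ∀ v : HeightOneSpectrum (𝓞 ↥(maximalRealSubfield L)), Measure ((cmDatum L 3 H).Local v))
      (νH : ∀ v : HeightOneSpectrum (𝓞 ↥(maximalRealSubfield L)),
    Measure ((cmDatum L 2 (Matrix.of fun i j : Fin 2 => if i.val + j.val + 1 = 2 then (1 : L) else 0)).Local v ×
      (cmDatum L 1 (Matrix.of fun i j : Fin 1 => if i.val + j.val + 1 = 1 then (1 : L) else 0)).Local v))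
      (ξloc : OneDimAutRepH L → ∀ v : HeightOneSpectrum (𝓞 ↥(maximalRealSubfield L)),
    (cmDatum L 2 (Matrix.of fun i j : Fin 2 => if i.val + j.val + 1 = 2 then (1 : L) else 0)).Local v ×
      (cmDatum L 1 (Matrix.of fun i j : Fin 1 => if i.val + j.val + 1 = 1 then (1 : L) else 0)).Local v →* ℂˣ)
      (μZ : ∀ v : HeightOneSpectrum (𝓞 ↥(maximalRealSubfield L)), Measure (Gqs L v ⧸ Subgroup.center (Gqs L v)))
      (keys : ∀ (ξ : OneDimAutRepH L) (v : HeightOneSpectrum (𝓞 ↥(maximalRealSubfield L))),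
    (∀ w : PlacesOver L v, IsCMField.complexConj L • w.1 = w.1) →
      {p : IrrClass (Gqs L v) × IrrClass (Gqs L v) //
        KeysCaseTwoLabels L v (μω.semilocalComponent L v) (torusLocalComponent L (IsCMField.complexConj L) v ξ.η)
          (torusLocalComponent L (IsCMField.complexConj L) v ξ.ψ) p.1 p.2 ∧
        p.1.IsSquareIntegrable (μZ v) ∧ ¬ p.2.IsSquareIntegrable (μZ v)})
      (hCM : ∀ (ξ : OneDimAutRepH L) (v : HeightOneSpectrum (𝓞 ↥(maximalRealSubfield L)))
    (hns : ∀ w : PlacesOver L v, IsCMField.complexConj L • w.1 = w.1)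
    (T : GL (Fin 3) (LocalRing L v)) (a : LocalRing L v) (ha : IsUnit a)
    (h : formCongr (conjLocal L (IsCMField.complexConj L) v) T (H.map (algebraMap L (LocalRing L v))) =
      a • (Matrix.of fun i j : Fin 3 => if i.val + j.val + 1 = 3 then (1 : L) else 0).map (algebraMap L (LocalRing L v)))
    (π2 πn : IrrClass (Gqs L v)),
    KeysCaseTwoLabels L v (μω.semilocalComponent L v) (torusLocalComponent L (IsCMField.complexConj L) v ξ.η)
      (torusLocalComponent L (IsCMField.complexConj L) v ξ.ψ) π2 πn → ¬ πn.IsSquareIntegrable (μZ v) →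
    CMNonsplitCharIdentityAt L v H (Δ v) (mH v) (mG v) (νG v) (νH v) (ξloc ξ v) (IrrClass.comap (cmDatumLocalCongr L v T ha h).symm πn))
      (_hHaar : ∀ v : HeightOneSpectrum (𝓞 ↥(maximalRealSubfield L)), (μZ v).IsHaarMeasure),
      -- DOCK: the theta-docking clause for every theta frame and every one-dimensional automorphic `ξ`
      (∀ {n' : ℕ} (e₁ : Fin 3 × Fin 1 ≃ Fin n') (dV : Fin 3 → L) (hdV : ∀ i, IsCMField.complexConj L (dV i) = dV i) (hdV0 : ∀ i, dV i ≠ 0) (g : GL (Fin 3) L)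
          (hg : ((g : Matrix (Fin 3) (Fin 3) L).map (cmConjRingHom L))ᵀ * H * (g : Matrix (Fin 3) (Fin 3) L) = Matrix.diagonal dV) (ξ : OneDimAutRepH L),
          CMThetaDockingClauses L H Δ mH mG νH νG ξ μω (ξloc ξ) e₁ dV hdV hdV0 g hg) ∧
      -- MEM: every local constituent class of a cotangent `P`'s finite component at a non-split `v` is a member of the packet of record of its `ξ`
      (∀ (W : Type) [AddCommGroup W] [Module ℂ W]
          (σ : Representation ℂ (finAdelic (↥(maximalRealSubfield L)) L (IsCMField.complexConj L) 3 H) W),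
          σ.IsIrreducible → σ.IsSmooth → σ.IsAdmissible →
        ∀ (P : DiscreteAutomorphicRep (adelicGroupData (↥(maximalRealSubfield L)) L (IsCMField.complexConj L) 3 H) μ),
          (P.IsHolCotangentAt (cmArchSection L ι H T hT) (cmCompactFactor L ι H T hT) ∨
            P.IsAntiholCotangentAt (cmArchSection L ι H T hT) (cmCompactFactor L ι H T hT)) →
          P.HasFinComponent σ →
        ∀ (ξ : OneDimAutRepH L),
          MemXiFamily P (transpose_map_cmConjRingHom_eq_of_frame L ι H T hT) (isUnit_det_of_frame L ι H T hT) μω hμu ξ →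
        ∀ (v : HeightOneSpectrum (𝓞 ↥(maximalRealSubfield L))),
          (∀ w : PlacesOver L v, IsCMField.complexConj L • w.1 = w.1) →
          ∀ c : IrrClass ((cmDatum L 3 H).Local v),
            (IrrClass.comap (localPiEquiv L (IsCMField.complexConj L) 3 H v) c).IsConstituentOf
                (σ.comp (inclPlace (↥(maximalRealSubfield L)) L (IsCMField.complexConj L) 3 H v)) →
            c ∈ (F0P3XiPacketFamilyOfRecord.xiPacketFamilyOfRecord L H (transpose_map_cmConjRingHom_eq_of_frame L ι H T hT)
              (isUnit_det_of_frame L ι H T hT) μω hμu Δ mH mG νG νH ξloc μZ keys hCM ξ v).members)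


/-! ## §2 EDITION 2 (T8-21 repair): the node ON TEST FUNCTIONS, PACKET-LEVEL — `StubD7αMemDockPerMeasureT` -/

set_option synthInstance.maxHeartbeats 400000 in
set_option maxHeartbeats 8000000 in
/-- **MEM + SHAPE + DOCKᵀ, PER MEASURE, PACKET-LEVEL (EDITION 2, the T8-21 ∕ s759 repair of the D7α node).**  §1's `StubD7αMemDockPerMeasure` (kept, ★ p839951 — the
negative edge) is a by-paste re-cut of the REGISTERED v1.13 text and inherits its two pre-repair tokens: the `hCM` ∃-binder (★ `CMNonsplitCharIdentityAt`, the (13.1.4)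
identity over ALL bare functions — constructible only from the mis-typed Q-CM letter) and the DOCK conjunct (★ `CMThetaDockingClauses`, whose hypothesis is that identity —
vacuous-true at Haar data); F0P2-p06 (g5) FINDING 2026-09-01T02:33:19Z (★ p840179), F0P2-ref1 (g5) r241 ④, director s759.  This edition states the node in the REPAIRED
currency and PACKET-LEVEL, so that it waits for no re-typing of the record family (R4 ∕ D19 (2)(w-b)): for every frame and every automorphic measure `μ` there exist transfer
data `(Δ, mH, mG)`, Haar families `νG` (Haar), `νH`, local characters `ξloc`, Haar measures `μZ v` on `U(Φ₃)(L⁺_v) ⧸ Z`, and a PACKET FAMILY `packFin ξ v` such that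
(DOCKᵀ) the theta-docking clause ON TEST FUNCTIONS ★ `CMThetaDockingClausesTest` holds for every theta frame and every `ξ` [Rogawski1990 Prop. 13.1.3 (d), 13.1.4; GR91
Lem. 5.1.2]; (SHAPE) at every non-split `v`, `packFin ξ v = ⟨πⁿ ∘ e, some πˢ⟩` with `(π², πⁿ)` the Keys labels of `JH(i_G(χ_ξ))` (`π²` square-integrable, `πⁿ` not),
`πˢ` supercuspidal, `πˢ ≠ πⁿ ∘ e`, and the identity (13.1.4) for `⟨πⁿ ∘ e, some πˢ⟩` ON TEST FUNCTIONS ★ `LocalAPacket.CharIdentityAtTest` [§12.2 (2); Prop. 13.1.4] — the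
binder block of ★ `F0P2oD7alphaMembersThetaClassTest.d7alpha_packet_members_thetaClassTest` (F0P2-p06 (g5)) token for token; (MEM_μ) every local constituent class of a
cotangent `μ`-discrete `P`'s finite component at a non-split `v` lies in `packFin ξ v` for every `ξ` with `MemXiFamily P … ξ` [Thm. 13.3.7, §14.6].  CONSUMER: PKΠ's
`stub_RIGfDict` re-proof (v1.15, desk pen) = `obtain` the data, at `(v, hns)` `obtain` SHAPE, then ★ `exists_isoAtXfCM_of_forall_mem` fed MEM_μ and, member by member, ★
`d7alpha_packet_members_thetaClassTest hLoc … (DOCKᵀ …) … hId`.  PRODUCER: `F0P2oD7alphaMemDockOfRows` ED. 2 at the kit family of record (`packFin := (𝔎 …).packFin`).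
No monotonicity from §1 is claimed (different currency).  An ENGINE node (closed `Prop` of the line tree, no cite tag on a closed-header `def`, D246), not a print letter.
(print: Rogawski1990, §13.1 Prop. 13.1.3 (d), Prop. 13.1.4 p. 199; §12.2 (2) pp. 173–174; Thm. 13.3.7; §14.6 p. 246) (print: GelbartRogawski1991, Lem. 5.1.2 p. 466) -/
def StubD7αMemDockPerMeasureT : Prop :=
  ∀ (L : Type) [Field L] [NumberField L] [IsCMField L] (ι : L →+* ℂ) (H : Matrix (Fin 3) (Fin 3) L) (T : GL (Fin 3) ℂ)
    (hT : (T : Matrix (Fin 3) (Fin 3) ℂ)ᴴ * H.map ι * (T : Matrix (Fin 3) (Fin 3) ℂ) = Literature.Geometry.ComplexHyperbolic.BallModel.J),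
    (∀ τ' : L →+* ℂ, InfinitePlace.mk τ' ≠ InfinitePlace.mk ι → (H.map τ').PosDef) → 2 ≤ Module.finrank ℚ ↥(maximalRealSubfield L) →
    ∀ (μω : HeckeCharacter L) (hμu : μω.IsUnitary),
      (∀ x : Literature.NumberTheory.GaloisRepresentations.ideleGroup ↥(maximalRealSubfield L), μω (AdeleRing.ideleBaseChange (↥(maximalRealSubfield L)) L x) = quadraticHeckeCharCM L x) →
    ∀ (μ : Measure (adelicGroupData (↥(maximalRealSubfield L)) L (IsCMField.complexConj L) 3 H).automorphicQuotient) [(adelicGroupData (↥(maximalRealSubfield L)) L (IsCMField.complexConj L) 3 H).IsAutomorphicMeasure μ],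
    letI : ∀ v : HeightOneSpectrum (𝓞 ↥(maximalRealSubfield L)), MeasurableSpace ((cmDatum L 3 H).Local v) := fun _ => borel _
    letI : ∀ v : HeightOneSpectrum (𝓞 ↥(maximalRealSubfield L)),
        MeasurableSpace ((cmDatum L 2 (Matrix.of fun i j : Fin 2 => if i.val + j.val + 1 = 2 then (1 : L) else 0)).Local v ×
          (cmDatum L 1 (Matrix.of fun i j : Fin 1 => if i.val + j.val + 1 = 1 then (1 : L) else 0)).Local v) := fun _ => borel _
    letI : ∀ (v : HeightOneSpectrum (𝓞 ↥(maximalRealSubfield L)))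
        (a : ((cmDatum L 2 (Matrix.of fun i j : Fin 2 => if i.val + j.val + 1 = 2 then (1 : L) else 0)).Local v ×
          (cmDatum L 1 (Matrix.of fun i j : Fin 1 => if i.val + j.val + 1 = 1 then (1 : L) else 0)).Local v)),
        MeasurableSpace (((cmDatum L 2 (Matrix.of fun i j : Fin 2 => if i.val + j.val + 1 = 2 then (1 : L) else 0)).Local v ×
            (cmDatum L 1 (Matrix.of fun i j : Fin 1 => if i.val + j.val + 1 = 1 then (1 : L) else 0)).Local v) ⧸
          Subgroup.centralizer ({a} : Set ((cmDatum L 2 (Matrix.of fun i j : Fin 2 => if i.val + j.val + 1 = 2 then (1 : L) else 0)).Local v ×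
            (cmDatum L 1 (Matrix.of fun i j : Fin 1 => if i.val + j.val + 1 = 1 then (1 : L) else 0)).Local v))) := fun _ _ => borel _
    letI : ∀ (v : HeightOneSpectrum (𝓞 ↥(maximalRealSubfield L))) (γ : (cmDatum L 3 H).Local v),
        MeasurableSpace ((cmDatum L 3 H).Local v ⧸ Subgroup.centralizer ({γ} : Set ((cmDatum L 3 H).Local v))) := fun _ _ => borel _
    letI : ∀ v : HeightOneSpectrum (𝓞 ↥(maximalRealSubfield L)), MeasurableSpace (Gqs L v ⧸ Subgroup.center (Gqs L v)) := fun _ => borel _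
    ∃ (Δ : ∀ v : HeightOneSpectrum (𝓞 ↥(maximalRealSubfield L)), LocalTransferFactor L H v)
      (mH : ∀ v : HeightOneSpectrum (𝓞 ↥(maximalRealSubfield L)),
    OrbitalMeasureFamily ((cmDatum L 2 (Matrix.of fun i j : Fin 2 => if i.val + j.val + 1 = 2 then (1 : L) else 0)).Local v ×
      (cmDatum L 1 (Matrix.of fun i j : Fin 1 => if i.val + j.val + 1 = 1 then (1 : L) else 0)).Local v))
      (mG : ∀ v : HeightOneSpectrum (𝓞 ↥(maximalRealSubfield L)), OrbitalMeasureFamily ((cmDatum L 3 H).Local v))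
      (νG : ∀ v : HeightOneSpectrum (𝓞 ↥(maximalRealSubfield L)), Measure ((cmDatum L 3 H).Local v))
      (νH : ∀ v : HeightOneSpectrum (𝓞 ↥(maximalRealSubfield L)),
    Measure ((cmDatum L 2 (Matrix.of fun i j : Fin 2 => if i.val + j.val + 1 = 2 then (1 : L) else 0)).Local v ×
      (cmDatum L 1 (Matrix.of fun i j : Fin 1 => if i.val + j.val + 1 = 1 then (1 : L) else 0)).Local v))
      (ξloc : OneDimAutRepH L → ∀ v : HeightOneSpectrum (𝓞 ↥(maximalRealSubfield L)),
    (cmDatum L 2 (Matrix.of fun i j : Fin 2 => if i.val + j.val + 1 = 2 then (1 : L) else 0)).Local v ×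
      (cmDatum L 1 (Matrix.of fun i j : Fin 1 => if i.val + j.val + 1 = 1 then (1 : L) else 0)).Local v →* ℂˣ)
      (μZ : ∀ v : HeightOneSpectrum (𝓞 ↥(maximalRealSubfield L)), Measure (Gqs L v ⧸ Subgroup.center (Gqs L v)))
      (packFin : OneDimAutRepH L → ∀ v : HeightOneSpectrum (𝓞 ↥(maximalRealSubfield L)), CMLocalAPacket L H v)
      (_hHaar : ∀ v : HeightOneSpectrum (𝓞 ↥(maximalRealSubfield L)), (μZ v).IsHaarMeasure)
      (_hνG : ∀ v : HeightOneSpectrum (𝓞 ↥(maximalRealSubfield L)), (νG v).IsHaarMeasure),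
      -- DOCKᵀ: the theta-docking clause ON TEST FUNCTIONS (★ `CMThetaDockingClausesTest`, T8-21) for every theta frame and every `ξ`
      (∀ {n' : ℕ} (e₁ : Fin 3 × Fin 1 ≃ Fin n') (dV : Fin 3 → L) (hdV : ∀ i, IsCMField.complexConj L (dV i) = dV i) (hdV0 : ∀ i, dV i ≠ 0) (g : GL (Fin 3) L)
          (hg : ((g : Matrix (Fin 3) (Fin 3) L).map (cmConjRingHom L))ᵀ * H * (g : Matrix (Fin 3) (Fin 3) L) = Matrix.diagonal dV) (ξ : OneDimAutRepH L),
          CMThetaDockingClausesTest L H Δ mH mG νH νG ξ μω (ξloc ξ) e₁ dV hdV hdV0 g hg) ∧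
      -- SHAPE: at every non-split `v` the packet of `ξ` is `⟨πⁿ ∘ e, some πˢ⟩` — Keys labels `(π², πⁿ)`, `πˢ` supercuspidal, `πˢ ≠ πⁿ ∘ e`, and the identity (13.1.4)
      -- for `⟨πⁿ ∘ e, some πˢ⟩` ON TEST FUNCTIONS (the binder block of ★ `F0P2oD7alphaMembersThetaClassTest.d7alpha_packet_members_thetaClassTest`, token for token)
      (∀ (ξ : OneDimAutRepH L) (v : HeightOneSpectrum (𝓞 ↥(maximalRealSubfield L))),
          (∀ w : PlacesOver L v, IsCMField.complexConj L • w.1 = w.1) →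
          ∃ (T : GL (Fin 3) (LocalRing L v)) (a : LocalRing L v) (ha : IsUnit a)
            (h : formCongr (conjLocal L (IsCMField.complexConj L) v) T (H.map (algebraMap L (LocalRing L v))) =
              a • (Matrix.of fun i j : Fin 3 => if i.val + j.val + 1 = 3 then (1 : L) else 0).map (algebraMap L (LocalRing L v)))
            (π2 πn : IrrClass (Gqs L v)) (πs : IrrClass ((cmDatum L 3 H).Local v)),
            KeysCaseTwoLabels L v (μω.semilocalComponent L v) (torusLocalComponent L (IsCMField.complexConj L) v ξ.η)
                (torusLocalComponent L (IsCMField.complexConj L) v ξ.ψ) π2 πn ∧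
              π2.IsSquareIntegrable (μZ v) ∧ ¬ πn.IsSquareIntegrable (μZ v) ∧ πs.IsSupercuspidal ∧
              πs ≠ IrrClass.comap (cmDatumLocalCongr L v T ha h).symm πn ∧
              (⟨IrrClass.comap (cmDatumLocalCongr L v T ha h).symm πn, some πs⟩ : CMLocalAPacket L H v).CharIdentityAtTest L H v
                (fun c f => c.smoothTrace (νG v) f) (ξloc ξ v) (νH v) (Δ v) (mH v) (mG v) ∧
              packFin ξ v = ⟨IrrClass.comap (cmDatumLocalCongr L v T ha h).symm πn, some πs⟩) ∧
      -- MEM_μ: every local constituent class of a cotangent `μ`-discrete `P`'s finite component at a non-split `v` is a member of `packFin ξ v`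
      (∀ (W : Type) [AddCommGroup W] [Module ℂ W]
          (σ : Representation ℂ (finAdelic (↥(maximalRealSubfield L)) L (IsCMField.complexConj L) 3 H) W),
          σ.IsIrreducible → σ.IsSmooth → σ.IsAdmissible →
        ∀ (P : DiscreteAutomorphicRep (adelicGroupData (↥(maximalRealSubfield L)) L (IsCMField.complexConj L) 3 H) μ),
          (P.IsHolCotangentAt (cmArchSection L ι H T hT) (cmCompactFactor L ι H T hT) ∨
            P.IsAntiholCotangentAt (cmArchSection L ι H T hT) (cmCompactFactor L ι H T hT)) →
          P.HasFinComponent σ →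
        ∀ (ξ : OneDimAutRepH L),
          MemXiFamily P (transpose_map_cmConjRingHom_eq_of_frame L ι H T hT) (isUnit_det_of_frame L ι H T hT) μω hμu ξ →
        ∀ (v : HeightOneSpectrum (𝓞 ↥(maximalRealSubfield L))),
          (∀ w : PlacesOver L v, IsCMField.complexConj L • w.1 = w.1) →
          ∀ c : IrrClass ((cmDatum L 3 H).Local v),
            (IrrClass.comap (localPiEquiv L (IsCMField.complexConj L) 3 H v) c).IsConstituentOf
                (σ.comp (inclPlace (↥(maximalRealSubfield L)) L (IsCMField.complexConj L) 3 H v)) →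
            c ∈ (packFin ξ v).members)

end Summit.HodgeConjecture.HodgeConjecture.Cruxes.H413.F0P2oD7alphaMemDockStatement

end
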